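import Summits.Ventures.DiscreteObjects.PP12.OrderFive

/-!
# PP(12), collineation of order 5 (fixed Fano subplane): the ORBIT MATRIX as a typed finite statement (plain matrix form)
Framing: lottery ticket; floor = certified bounds/negative ranges.

Cell pub-namedobj (venture DiscreteObjects), target (M), designs gen 15; the order-5 sibling of `FlagOrbitMatrix` (p344983). By
`OrderFive.fano_of_pow_five` a collineation `σ ≠ 1` with `σ⁵ = 1` of a projective plane of order 12 fixes exactly a Fano subplane (7 points,
7 lines, 3 fixed points on each fixed line, 3 fixed lines through each fixed point). The non-trivial orbits (length 5): on each fixed line `μ` the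
`10` non-fixed ('tangent') points form two orbits `(μ, a)`, `a : Fin 2`; the `80` points on no fixed line ('exterior') form `16` orbits; dually two
orbits `(x, a)` of non-fixed lines through each fixed point `x` and `16` orbits of exterior lines (designs g10 FAMILY-P5PLANE §1; in print Janko–van Trung
1982). So the non-trivial part of the tactical decomposition is a `30 × 30` matrix over the index type `F5Idx = (Fin 7 × Fin 2) ⊕ Fin 16`.
`IsFanoFiveOrbitMatrix M` is the PLAIN MATRIX FORM of its `λ = 1` equations for `M r c = |(point orbit c) ∩ (a line of row orbit r)|`: row and column totals
(`12` for tangent rows/columns — one fixed point on a tangent line —, `13` for exterior ones), and the complete systems of row and of column inner products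
(a row with itself `12 + 5 − 5·#fixed points` = `12` / `17`; two distinct rows `5`, except `0` for two tangent-line orbits through the same fixed point;
dually). The finer structure used by designs g10's engines (the signs `ε`, `m(x, μ)`, the incidence of the Fano subplane) is NOT built in; it is implied
data a solver may add. `FanoFiveReduction` (plane ⇒ matrix) is typed here; its proof needs the prime-order orbit identities (`OrbitCountPrimeOrder`,
designs g15) and the indexing of the orbits (successor item, pattern of `FlagOrbitReduction`). `NoOrderFiveOrder12` is the plane-level census statement
(in print: EXCLUDED, Janko–van Trung 1982; outside the kernel: designs g10's orbit-level replication EMPTY, two implementations + referee spot checks —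
on g10's structured model, not on this plain form). Nothing here depends on any computation. No `sorry`, no new axioms.
-/

namespace Summit.Ventures.DiscreteObjects.PP12

open Configuration Finset
open scoped Classical

/-- Index of the non-trivial orbits for `σ⁵ = 1` on PP(12): tangent orbit `(x, a)` (through / on the fixed element `x : Fin 7`, `a : Fin 2`) |
exterior orbit `e : Fin 16`. Used for rows (line orbits) and columns (point orbits) alike. -/
abbrev F5Idx := (Fin 7 × Fin 2) ⊕ Fin 16

namespace FanoFive

/-- Row/column totals over the non-trivial orbits: `13 −` the number of fixed points on a line of the orbit (`1` on a tangent line, `0` on an exterior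
line); the same numbers for columns. -/
def total : F5Idx → ℕ
  | Sum.inl _ => 12
  | Sum.inr _ => 13

/-- Forced inner products (`λ = 1` summed over an orbit of length 5, fixed part eliminated): with itself `n + 5 − 5·#fixed` = `12` (tangent) / `17`
(exterior); two distinct orbits `5`, except `0` for two tangent orbits at the same fixed element (they share it). Rows and columns alike. -/
def target : F5Idx → F5Idx → ℕ
  | Sum.inl (x, a), Sum.inl (y, b) => if (x, a) = (y, b) then 12 else if x = y then 0 else 5
  | Sum.inr e, Sum.inr e' => if e = e' then 17 else 5
  | _, _ => 5

end FanoFive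

/-- **The orbit-matrix equations for a collineation of order 5 of a projective plane of order 12** (plain matrix form, `30 × 30` non-trivial part). -/
def IsFanoFiveOrbitMatrix (M : F5Idx → F5Idx → ℕ) : Prop :=
  (∀ r : F5Idx, ∑ c : F5Idx, M r c = FanoFive.total r) ∧
  (∀ c : F5Idx, ∑ r : F5Idx, M r c = FanoFive.total c) ∧
  (∀ r r' : F5Idx, ∑ c : F5Idx, M r c * M r' c = FanoFive.target r r') ∧
  (∀ c c' : F5Idx, ∑ r : F5Idx, M r c * M r c' = FanoFive.target c c')

/-- **Census statement at the orbit level (typed; UNDECIDED in this plain form):** no orbit matrix for a collineation of order 5 of PP(12). -/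
def NoFanoFiveOrbitMatrix : Prop := ∀ M : F5Idx → F5Idx → ℕ, ¬ IsFanoFiveOrbitMatrix M

/-- **Census statement at plane level, order-5 cell (typed; in print EXCLUDED, Janko–van Trung 1982):** a projective plane of order 12 has no collineation
of order 5. -/
def NoOrderFiveOrder12 : Prop :=
  ∀ (P L : Type) [Membership P L] [Fintype P] [Fintype L] [ProjectivePlane P L],
    ProjectivePlane.order P L = 12 → ∀ σ : Collineation P L, σ.onPoints ^ 5 = 1 → σ.onPoints = 1

/-- **The orbit-matrix reduction of the order-5 cell** (typed; NOT proved here): every projective plane of order 12 with a collineation `σ ≠ 1`,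
`σ⁵ = 1` yields a matrix satisfying `IsFanoFiveOrbitMatrix`. -/
def FanoFiveReduction : Prop :=
  ∀ (P L : Type) [Membership P L] [Fintype P] [Fintype L] [ProjectivePlane P L],
    ProjectivePlane.order P L = 12 → ∀ σ : Collineation P L, σ.onPoints ^ 5 = 1 → σ.onPoints ≠ 1 →
      ∃ M : F5Idx → F5Idx → ℕ, IsFanoFiveOrbitMatrix M

/-- **How the census uses the orbit level:** reduction + emptiness of the orbit level close the order-5 cell. Pure logic. -/
theorem noOrderFive_of_fanoFiveReduction (hred : FanoFiveReduction) (hno : NoFanoFiveOrbitMatrix) : NoOrderFiveOrder12 := by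
  intro P L _ _ _ _ h12 σ hq
  by_contra hne
  obtain ⟨M, hM⟩ := hred P L h12 σ hq hne
  exact hno M hM

namespace IsFanoFiveOrbitMatrix

variable {M : F5Idx → F5Idx → ℕ}

/-- Sanity of the encoding: two tangent-line orbits through the same fixed point are orthogonal over the non-trivial columns. -/
theorem tangent_rows_orthogonal (h : IsFanoFiveOrbitMatrix M) (x : Fin 7) {a b : Fin 2} (hab : a ≠ b) :
    ∑ c : F5Idx, M (Sum.inl (x, a)) c * M (Sum.inl (x, b)) c = 0 := by
  rw [h.2.2.1]; simp [FanoFive.target, hab]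

/-- Sanity of the encoding: an exterior row has norm `17 = n + 5`. -/
theorem exterior_row_norm (h : IsFanoFiveOrbitMatrix M) (e : Fin 16) :
    ∑ c : F5Idx, M (Sum.inr e) c * M (Sum.inr e) c = 17 := by
  rw [h.2.2.1]; simp [FanoFive.target]

end IsFanoFiveOrbitMatrix

end Summit.Ventures.DiscreteObjects.PP12
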